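import Literature.AlgebraicGeometry.ComplexMultiplication.CyclotomicCMTypeResidueSets
import HarnessLib

/-!
# CM residue sets of `ℤ/N` as subsets of a fixed half-system: the cheap enumeration of the CM types of `ℚ(ζ_N)`

Layer `Literature/AlgebraicGeometry/ComplexMultiplication`; a composite-level companion of §2 of seat p29's dictionary
`CyclotomicCMTypeResidueSets` (there: odd PRIME level `p = 2n + 1`, CM residue sets `↔` positive halves `T ⊆ {1, …, n}`,
`cmSetOf`, `mem_cmResidueSets_iff`, `ncard_setOf_eq_card_filter_powerset`).  Lane `lit-hodgefound` (Track 2 foundations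
library), prover seat `lit-hodgefound-p10`, generation 34, row «A3-(half-system enumeration)» (self-proposed 2026-08-28).
Everything is PROVED, THEOREMS ONLY (no definition, no named fact; net debt 0).

THE PRINT.  G. Shimura, *Abelian Varieties with Complex Multiplication and Modular Functions* (1998), §8.4 Example (1),
p. 64–65: for `F = ℚ(ζ)` a CM type is a set `S = {φ₁, …, φₙ}` of embeddings containing «no two automorphisms … which are
complex conjugate of each other», read on exponents a subset `S ⊂ G ≅ (ℤ/N)ˣ` with `S ⊔ (−S) = G` (p29's `IsCMResidueSet`);
«we obtain 32 CM-types» (`2^{n−1}` normalised, `2ⁿ` in all) by choosing one sign in each pair `{c, −c}`.  THIS FILE makes the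
sign choice relative to an ARBITRARY fixed CM residue set `H` (a half-system of the units) instead of `{1, …, n}` — which is a
half-system only for prime level:

* `isCMResidueSet_union_image_neg` — for `T ⊆ H`, `T ∪ −(H ∖ T)` is a CM residue set; `union_image_neg_inter` — its trace on `H`
  is `T`; `inter_union_image_neg_eq_self` — every CM residue set `S` is `(S ∩ H) ∪ −(H ∖ S)`;
* **`mem_image_powerset_iff`** — `S ∈ {T ∪ −(H ∖ T) | T ⊆ H} ↔ S` is a CM residue set; **`allCMResidueSets_eq_image_powerset`** —
  p29's family `allCMResidueSets N` (by definition a filter over ALL `2^{φ(N)}` subsets of the units) is the image of the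
  `2^{φ(N)/2}` subsets of `H`: the rewrite under which the finite censuses of composite level (`N = 21, 28, 36`, `φ(N) = 12`:
  `2¹²` subsets versus `2⁶`) are kernel-`decide`d in seconds; `union_image_neg_injOn`, **`card_allCMResidueSets_eq`**
  (`= 2^{|H|} = 2^{φ(N)/2}`), **`card_filter_allCMResidueSets_eq`** (counting over CM residue sets = counting over subsets of `H`);
* **`ncard_setOf_eq_card_filter_powerset_half`** — for the CM types of `L = ℚ(ζ_N)`: `#{Φ | Q Φ} = #{T ⊆ H | P (T ∪ −(H ∖ T))}`
  whenever `Q` is read on residue sets by `P` (p29's `ncard_setOf_eq_card_filter` composed with the above);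
  `natCard_cmType_eq_card_allCMResidueSets`.

USAGE (measured on the farm, level `21`, `H = {1,2,4,5,8,10}`): a census fact is stated in COUNTING FORM
`((allCMResidueSets N).filter P).card = m` (inner quantifiers over `unitResidues N` only), rewritten with
`card_filter_allCMResidueSets_eq hH` and closed by `decide +kernel` in about a second; universally quantified forms
`∀ S ∈ allCMResidueSets N, …` are then DERIVED with `Finset.filter_eq_empty_iff` (deciding them directly, or any statement
with a binder ranging over `Finset (ZMod N)`, does not terminate in practice).

## References

* [Shimura1998] G. Shimura, *Abelian Varieties with Complex Multiplication and Modular Functions*, Princeton Univ. Press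
  (1998), §8.4 Example (1), pp. 64–65 (held chunks p0085–p0086); §8.2 Prop. 26.
* [Washington1997] L. C. Washington, *Introduction to Cyclotomic Fields*, 2nd ed., GTM 83 (1997), Thm. 2.5
  (`Gal(ℚ(ζ_N)/ℚ) ≅ (ℤ/N)ˣ`, `|(ℤ/N)ˣ| = φ(N)`).
-/

set_option autoImplicit false

noncomputable section

namespace Literature.AlgebraicGeometry.ComplexMultiplication

open Literature.AlgebraicGeometry.Motives (CMType)
open Literature.AlgebraicGeometry.Pohlmann1968 Literature.AlgebraicGeometry.Pohlmann1968.Cyclotomic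
open Literature.NumberTheory.ComplexMultiplication
open NumberField

namespace CyclotomicCMTypeResidueSets

variable {N : ℕ} [NeZero N]

/-! ## §1 Units and their negatives -/

/-- A residue is a unit residue iff it is a unit of `ℤ/N` (the tree's `mem_unitResidues_iff_isUnit` of
`CyclotomicCMTypeIsogenyClasses`, re-proved here to keep this file's imports light). [cite: Washington1997, Thm. 2.5] -/
private theorem mem_unitResidues_iff_isUnit₀ (c : ZMod N) : c ∈ unitResidues N ↔ IsUnit c := by
  rw [← coprime_iff_mem_unitResidues]
  constructor
  · intro h
    have hu := (ZMod.unitOfCoprime c.val h).isUnit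
    rwa [ZMod.coe_unitOfCoprime, ZMod.natCast_zmod_val] at hu
  · rintro ⟨u, rfl⟩
    exact ZMod.val_coe_unit_coprime u

/-- `−c` is a unit residue if `c` is. [cite: Washington1997, Thm. 2.5] -/
theorem neg_mem_unitResidues {c : ZMod N} (hc : c ∈ unitResidues N) : -c ∈ unitResidues N := by
  rw [mem_unitResidues_iff_isUnit₀] at hc ⊢
  exact hc.neg

/-- `−c` is a unit residue iff `c` is. [cite: Washington1997, Thm. 2.5] -/
theorem neg_mem_unitResidues_iff' (c : ZMod N) : -c ∈ unitResidues N ↔ c ∈ unitResidues N :=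
  ⟨fun h => neg_neg c ▸ neg_mem_unitResidues h, neg_mem_unitResidues⟩

/-- In a CM residue set `H`, a unit outside `H` has its negative inside (`H ⊔ −H = (ℤ/N)ˣ`). [cite: Shimura1998, §8.4 Example (1)] -/
theorem IsCMResidueSet.neg_mem_of_not_mem {H : Finset (ZMod N)} (hH : IsCMResidueSet N H) {c : ZMod N}
    (hc : c ∈ unitResidues N) (hcH : c ∉ H) : -c ∈ H :=
  not_not.1 fun hh => hcH ((hH.2 c hc).2 hh)

/-- In a CM residue set `H`, a member has its negative outside (`H ⊓ −H = ∅`). [cite: Shimura1998, §8.4 Example (1)] -/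
theorem IsCMResidueSet.neg_not_mem_of_mem {H : Finset (ZMod N)} (hH : IsCMResidueSet N H) {c : ZMod N} (hcH : c ∈ H) :
    -c ∉ H :=
  (hH.2 c (hH.1 hcH)).1 hcH

/-! ## §2 The sign choices relative to a fixed half-system `H` -/

omit [NeZero N] in
/-- Membership in `T ∪ −(H ∖ T)` (unfolding). [cite: Shimura1998, §8.4 Example (1)] -/
theorem mem_union_image_neg_iff (H T : Finset (ZMod N)) (c : ZMod N) :
    c ∈ T ∪ (H \ T).image Neg.neg ↔ c ∈ T ∨ (-c ∈ H ∧ -c ∉ T) := by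
  rw [Finset.mem_union, Finset.mem_image]
  constructor
  · rintro (h | ⟨d, hd, hdc⟩)
    · exact Or.inl h
    · rw [Finset.mem_sdiff] at hd
      rw [← hdc, neg_neg]
      exact Or.inr hd
  · rintro (h | ⟨h1, h2⟩)
    · exact Or.inl h
    · exact Or.inr ⟨-c, Finset.mem_sdiff.2 ⟨h1, h2⟩, neg_neg c⟩

/-- **`T ∪ −(H ∖ T)` is a CM residue set** for every subset `T` of a CM residue set `H`: choosing, in each pair `{h, −h}`
(`h ∈ H`), the sign `h` for `h ∈ T` and `−h` otherwise («no two … complex conjugate of each other»).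
[cite: Shimura1998, §8.4 Example (1)] -/
theorem isCMResidueSet_union_image_neg {H : Finset (ZMod N)} (hH : IsCMResidueSet N H) {T : Finset (ZMod N)}
    (hT : T ⊆ H) : IsCMResidueSet N (T ∪ (H \ T).image Neg.neg) := by
  refine ⟨fun c hc => ?_, fun c hc => ?_⟩
  · rcases (mem_union_image_neg_iff H T c).1 hc with h | ⟨h, -⟩
    · exact hH.1 (hT h)
    · exact (neg_mem_unitResidues_iff' c).1 (hH.1 h)
  · rw [mem_union_image_neg_iff, mem_union_image_neg_iff, neg_neg]
    by_cases hcH : c ∈ H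
    · have hnc : -c ∉ H := hH.neg_not_mem_of_mem hcH
      constructor
      · rintro (hcT | ⟨hn, -⟩)
        · rintro (hnT | ⟨-, hcT'⟩)
          · exact hnc (hT hnT)
          · exact hcT' hcT
        · exact absurd hn hnc
      · intro h
        by_contra hcT
        exact h (Or.inr ⟨hcH, fun hh => hcT (Or.inl hh)⟩)
    · have hnc : -c ∈ H := hH.neg_mem_of_not_mem hc hcH
      constructor
      · rintro (hcT | ⟨-, hnT⟩)
        · exact absurd (hT hcT) hcH
        · rintro (hnT' | ⟨hc', -⟩)
          · exact hnT hnT'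
          · exact hcH hc'
      · intro h
        exact Or.inr ⟨hnc, fun hh => h (Or.inl hh)⟩

/-- The trace of `T ∪ −(H ∖ T)` on `H` is `T`. [cite: Shimura1998, §8.4 Example (1)] -/
theorem union_image_neg_inter {H : Finset (ZMod N)} (hH : IsCMResidueSet N H) {T : Finset (ZMod N)} (hT : T ⊆ H) :
    (T ∪ (H \ T).image Neg.neg) ∩ H = T := by
  ext c
  rw [Finset.mem_inter, mem_union_image_neg_iff]
  constructor
  · rintro ⟨hc | ⟨hn, -⟩, hcH⟩
    · exact hc
    · exact absurd hn (hH.neg_not_mem_of_mem hcH)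
  · intro hc
    exact ⟨Or.inl hc, hT hc⟩

/-- **Every CM residue set is the sign choice of its trace on `H`**: `S = (S ∩ H) ∪ −(H ∖ S)`. [cite: Shimura1998, §8.4 Example (1)] -/
theorem inter_union_image_neg_eq_self {H : Finset (ZMod N)} (hH : IsCMResidueSet N H) {S : Finset (ZMod N)}
    (hS : IsCMResidueSet N S) : (S ∩ H) ∪ (H \ (S ∩ H)).image Neg.neg = S := by
  ext c
  rw [mem_union_image_neg_iff, Finset.mem_inter, Finset.mem_inter]
  constructor
  · rintro (⟨hcS, -⟩ | ⟨hnH, hnot⟩)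
    · exact hcS
    · have hnS : -c ∉ S := fun h => hnot ⟨h, hnH⟩
      exact (hS.2 c ((neg_mem_unitResidues_iff' c).1 (hH.1 hnH))).2 hnS
  · intro hcS
    have hcu := hS.1 hcS
    by_cases hcH : c ∈ H
    · exact Or.inl ⟨hcS, hcH⟩
    · exact Or.inr ⟨hH.neg_mem_of_not_mem hcu hcH, fun h => hS.neg_not_mem_of_mem hcS h.1⟩

/-- **CM residue sets `↔` subsets of a fixed half-system**: `S` lies in the image of `T ↦ T ∪ −(H ∖ T)` over the subsets
`T ⊆ H` iff `S` is a CM residue set (the `2ⁿ` sign choices, `n = φ(N)/2`, «we obtain 32 CM-types» normalised for `p = 13`).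
[cite: Shimura1998, §8.4 Example (1)] -/
theorem mem_image_powerset_iff {H : Finset (ZMod N)} (hH : IsCMResidueSet N H) (S : Finset (ZMod N)) :
    S ∈ H.powerset.image (fun T => T ∪ (H \ T).image Neg.neg) ↔ IsCMResidueSet N S := by
  rw [Finset.mem_image]
  constructor
  · rintro ⟨T, hT, rfl⟩
    exact isCMResidueSet_union_image_neg hH (Finset.mem_powerset.1 hT)
  · intro hS
    exact ⟨S ∩ H, Finset.mem_powerset.2 Finset.inter_subset_right, inter_union_image_neg_eq_self hH hS⟩

/-- `allCMResidueSets N` enumerates exactly the CM residue sets (p29's definition, membership unfolded). [cite: Shimura1998, §8.4 Example (1)] -/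
private theorem mem_allCMResidueSets_iff₀ (S : Finset (ZMod N)) : S ∈ allCMResidueSets N ↔ IsCMResidueSet N S := by
  rw [allCMResidueSets, Finset.mem_filter, Finset.mem_powerset]
  exact ⟨fun h => h.2, fun h => ⟨h.1, h⟩⟩

/-- **THE CHEAP ENUMERATION**: p29's family of all CM residue sets of `ℤ/N` — by definition the filter of the `2^{φ(N)}` subsets
of the units — is the image of the `2^{φ(N)/2}` subsets of any one CM residue set `H` under `T ↦ T ∪ −(H ∖ T)`.
[cite: Shimura1998, §8.4 Example (1)] -/
theorem allCMResidueSets_eq_image_powerset {H : Finset (ZMod N)} (hH : IsCMResidueSet N H) :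
    allCMResidueSets N = H.powerset.image (fun T => T ∪ (H \ T).image Neg.neg) := by
  ext S
  rw [mem_allCMResidueSets_iff₀, mem_image_powerset_iff hH]

/-- `T ↦ T ∪ −(H ∖ T)` is injective on the subsets of `H`. [cite: Shimura1998, §8.4 Example (1)] -/
theorem union_image_neg_injOn {H : Finset (ZMod N)} (hH : IsCMResidueSet N H) :
    Set.InjOn (fun T => T ∪ (H \ T).image Neg.neg) ↑H.powerset := by
  intro T hT T' hT' h
  rw [Finset.mem_coe, Finset.mem_powerset] at hT hT'
  have h' : (T ∪ (H \ T).image Neg.neg) ∩ H = (T' ∪ (H \ T').image Neg.neg) ∩ H := by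
    simp only at h
    rw [h]
  rwa [union_image_neg_inter hH hT, union_image_neg_inter hH hT'] at h'

/-- **`ℤ/N` has `2^{|H|}` CM residue sets**, `H` any one of them. [cite: Shimura1998, §8.4 Example (1)] -/
theorem card_allCMResidueSets_eq {H : Finset (ZMod N)} (hH : IsCMResidueSet N H) : (allCMResidueSets N).card = 2 ^ H.card := by
  rw [allCMResidueSets_eq_image_powerset hH, Finset.card_image_of_injOn (union_image_neg_injOn hH), Finset.card_powerset]

/-- **`ℤ/N` has `2^{φ(N)/2}` CM residue sets** (as soon as it has one: `2|H| = φ(N)` by p29's `two_mul_card_eq_card_unitResidues`).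
[cite: Shimura1998, §8.4 Example (1)] [cite: Washington1997, Thm. 2.5] -/
theorem card_allCMResidueSets_eq_two_pow_totient_div_two {H : Finset (ZMod N)} (hH : IsCMResidueSet N H) :
    (allCMResidueSets N).card = 2 ^ (N.totient / 2) := by
  have h2 := two_mul_card_eq_card_unitResidues hH
  rw [card_unitResidues] at h2
  rw [card_allCMResidueSets_eq hH, show N.totient / 2 = H.card by omega]

/-- **Counting over CM residue sets = counting over the subsets of `H`.** [cite: Shimura1998, §8.4 Example (1)] -/
theorem card_filter_allCMResidueSets_eq {H : Finset (ZMod N)} (hH : IsCMResidueSet N H) (P : Finset (ZMod N) → Prop)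
    [DecidablePred P] :
    ((allCMResidueSets N).filter P).card = (H.powerset.filter fun T => P (T ∪ (H \ T).image Neg.neg)).card := by
  rw [allCMResidueSets_eq_image_powerset hH, Finset.filter_image, Finset.card_image_of_injOn]
  exact (union_image_neg_injOn hH).mono fun T hT => (Finset.mem_filter.1 hT).1

/-- A universally quantified property of CM residue sets is checked on the subsets of `H`. [cite: Shimura1998, §8.4 Example (1)] -/
theorem forall_allCMResidueSets_iff {H : Finset (ZMod N)} (hH : IsCMResidueSet N H) (P : Finset (ZMod N) → Prop) :
    (∀ S ∈ allCMResidueSets N, P S) ↔ ∀ T ∈ H.powerset, P (T ∪ (H \ T).image Neg.neg) := by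
  rw [allCMResidueSets_eq_image_powerset hH, Finset.forall_mem_image]

/-! ## §3 Counting CM types of `ℚ(ζ_N)` over the subsets of a half-system -/

variable (N)
variable {L : Type} [Field L] [NumberField L] [IsCyclotomicExtension {N} ℚ L]

/-- **Counting CM types of `ℚ(ζ_N)` by sign choices relative to `H`**: for a property `Q` of CM types read on residue sets by a
decidable `P`, `#{Φ | Q Φ} = #{T ⊆ H | P (T ∪ −(H ∖ T))}` — the composite-level form of p29's prime-level
`ncard_setOf_eq_card_filter_powerset`, in which the censuses of `ℚ(ζ₂₁)`, `ℚ(ζ₂₈)`, `ℚ(ζ₃₆)` are `decide`d.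
[cite: Shimura1998, §8.4 Example (1)] -/
theorem ncard_setOf_eq_card_filter_powerset_half {H : Finset (ZMod N)} (hH : IsCMResidueSet N H) (Q : CMType L → Prop)
    (P : Finset (ZMod N) → Prop) [DecidablePred P] (hQP : ∀ Φ : CMType L, Q Φ ↔ P (residueSet N Φ)) :
    {Φ : CMType L | Q Φ}.ncard = (H.powerset.filter fun T => P (T ∪ (H \ T).image Neg.neg)).card := by
  rw [ncard_setOf_eq_card_filter N (allCMResidueSets N) mem_allCMResidueSets_iff₀ Q P hQP, card_filter_allCMResidueSets_eq hH]

/-- The residue set of every CM type of `ℚ(ζ_N)` is one of the sign choices relative to `H`. [cite: Shimura1998, §8.4 Example (1)] -/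
theorem residueSet_mem_image_powerset {H : Finset (ZMod N)} (hH : IsCMResidueSet N H) (Φ : CMType L) :
    residueSet N Φ ∈ H.powerset.image (fun T => T ∪ (H \ T).image Neg.neg) :=
  (mem_image_powerset_iff hH _).2 (isCMResidueSet_residueSet N Φ)

/-- **The number of CM types of `ℚ(ζ_N)` read on residues**: `Nat.card (CMType L) = |allCMResidueSets N| = 2^{φ(N)/2}` (p29's
`cmTypeEquivResidueSets`). [cite: Shimura1998, §8.4 Example (1)] -/
theorem natCard_cmType_eq_card_allCMResidueSets : Nat.card (CMType L) = (allCMResidueSets N).card := by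
  classical
  rw [Nat.card_congr (cmTypeEquivResidueSets N (L := L)), Nat.card_eq_fintype_card, Fintype.card_subtype]
  congr 1
  ext S
  rw [Finset.mem_filter, mem_allCMResidueSets_iff₀]
  exact ⟨fun h => h.2, fun h => ⟨Finset.mem_univ _, h⟩⟩

end CyclotomicCMTypeResidueSets

end Literature.AlgebraicGeometry.ComplexMultiplication

end
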